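import Literature.MathematicalPhysics.QuantumFieldTheory.QCDTransferMatrix
import Literature.MathematicalPhysics.QuantumLattice.GaugeGroups

/-!
# Dictionary: Smit's one-particle gauge rotation on a time slice is the temporal transporter
(crux `QuarksAsStableAction.StableActionBridge`, item stmt-QuantumFields-9737, line `Sketch`;
registered stub `sliceGaugeRot_timeSlice_apply` of the lead skeleton)

The landed Wilson-determinant transfer form (`wilson_det_transfer_form`) uses, on the index
`TorusSite 3 L × Fin 3 × Fin 4` (site, colour, spin) of one time slice `t` of the four-torus, the
explicit temporal transporter

  `W t := fun a b =>
    if a.1 = b.1 ∧ a.2.2 = b.2.2 then ρ (U (Fin.cons t a.1, 0)) a.2.1 b.2.1 else 0`,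

i.e. the block-diagonal, spin-blind matrix of the temporal links `U_{(t,x),0}` leaving slice `t`
in the fundamental representation `ρ`.  Smit's transfer-matrix vocabulary
(`QCDTransferMatrix.lean`) has the one-particle gauge rotation of a time-independent gauge
transformation `g : TorusSite 3 S → SU(3)`,

  `sliceGaugeRot g :=
    sliceKron (fun p q => if p.1 = q.1 ∧ p.2.1 = q.2.1 then g p.2.1 p.2.2 q.2.2 else 0) 1`

on `Fin Nf × (TorusSite 3 S × Fin 3 × Fin 4)` (Smit, *Introduction to Quantum Fields on a
Lattice*, §4.6 (4.124)–(4.126)).  This file records the dictionary entry between the two: for one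
flavour (`Nf = 1`, both flavour components `0 : Fin 1`) and `g y := U (Fin.cons t y, 0)` the two
matrices agree entrywise.  The proof is definitional unfolding of `sliceGaugeRot`, `sliceKron`,
`Matrix.one_apply` and `fundamentalRep_apply`, followed by a case split on the two Kronecker
deltas.

[cite: Smit2023, §4.6 (4.124)–(4.126)]
-/

noncomputable section

open MeasureTheory Matrix Literature.MathematicalPhysics.QuantumFieldTheory
  Literature.MathematicalPhysics.QuantumLattice
open Literature.Probability.LatticeModels (TorusSite)

namespace Summit.QuantumFields.QCD.Cruxes.StableActionBridge.Sketch

/-- **Dictionary entry**: for one flavour, Smit's one-particle gauge rotation `sliceGaugeRot g`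
of the slice quark modes by the temporal links `g y := U_{(t,y),0}` leaving the time slice `t` is,
entry by entry, the temporal transporter
`W t = (δ_{x,x'} δ_{α,α'} ρ(U_{(t,x),0})_{a a'})` of the Wilson-determinant transfer form
(site `x`, colour `a`, spin `α`; `ρ` the fundamental representation of `SU(3)`).
[cite: Smit2023, §4.6 (4.124)–(4.126)] -/
theorem sliceGaugeRot_timeSlice_apply : ∀ (L : ℕ) [NeZero L] (U : GaugeConfig 4 L (Matrix.specialUnitaryGroup (Fin 3) ℂ)) (t : ZMod L) (a b : TorusSite 3 L × Fin 3 × Fin 4), sliceGaugeRot (Nf := 1) (fun y : TorusSite 3 L => U ((Fin.cons t y : TorusSite 4 L), 0)) (0, a) (0, b) = (if a.1 = b.1 ∧ a.2.2 = b.2.2 then fundamentalRep (Fin 3) (U ((Fin.cons t a.1 : TorusSite 4 L), 0)) a.2.1 b.2.1 else 0) := by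
  intro L _ U t a b
  simp only [sliceGaugeRot, sliceKron, Matrix.of_apply, Matrix.one_apply, fundamentalRep_apply,
    true_and]
  by_cases h1 : a.1 = b.1 <;> by_cases h2 : a.2.2 = b.2.2 <;> simp [h1, h2]

end Summit.QuantumFields.QCD.Cruxes.StableActionBridge.Sketch

end
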